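import Literature.Probability.LatticeModels.RCRepresentation
import Literature.Probability.LatticeModels.RandomClusterDomainMarkov
import HarnessLib

/-!
# Random-cluster contours, XII: boxes — free edges, the spine graph, and the transfer of energy and cluster counts

Topic `Literature/Probability/LatticeModels`. The combinatorial dictionary between the contour volumes
`(σ, freeEdges Λ_{M+2}, ω̃)` of `RCContours` on the box `Λ_{M+2}` and finite-graph configurations of the box
`Λ_M` in the formalism of `RandomCluster.lean` / `RandomClusterDomainMarkov.lean` (Grimmett 2006, §4.2):

* §1 `core Λ_{M+2} = Λ_M`, `inner1 Λ_{N+1} = Λ_N`, and **the free edges of `Λ_{M+2}`** are the lattice edges with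
  both endpoints in `Λ_M` and one in `Λ_{M-1}` — the edges of `Λ_M` off the boundary layer `∂Λ_M`
  (`mk_mem_freeEdges_box`; FV Lemma 7.20 made explicit for boxes);
* §2 the **spine graph** `spineGraph d M = finsetGraph (ambM d M) Λ_M` on `↥Λ_M` (all edges of `Λ_M` except those
  inside `∂Λ_M`; on `Λ_{M-1}` the ambient graph `ambM` is the full lattice), the lift `liftE` of its edges to
  lattice edges, and the bijection of its configurations with those of the free edges
  (`image_liftE_edgeFinset`, `powerset_freeEdges_eq_image`);
* §3 the energy of a lifted configuration: `2|ω|` for `dis`, `2|ω| + pinned` for `ord` (double counting);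
* §4 the number of classes of a relation on a finite set is the number of connected components of the matching
  graph (`ccount_eq_natCard_connectedComponent`), whence the cluster functional of a lifted configuration:
  `κ^{dis} = k^{free}(ω) + |Λ_{M+2} ∖ Λ_M|` (`kappa_dis_box`) and `κ^{ord} + 1 = k^{∂Λ_M wired}(ω)`
  (`kappa_ord_box`, gluing the shell `Λ_{M+2} ∖ Λ_{M-1}` to the wired class through pinned open edges).

Everything is proved; no named facts.

## References

* G. Grimmett, *The Random-Cluster Model*, Springer 2006, §4.2 (E_Λ, ∂Λ, (4.11)–(4.12)), §7.5 (7.63)–(7.66). [Grimmett2006]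
* S. Friedli, Y. Velenik, *Statistical Mechanics of Lattice Systems*, CUP 2017, §7.3, Lemma 7.20. [FriedliVelenik2017]
-/

noncomputable section

open Finset Relation

namespace Literature.Probability.LatticeModels

namespace RCC

open ContourSetup ClassCount

variable {d : ℕ}

/-! ### 1. Boxes: core, inner volume, free edges -/

/-- The radius-2 ball fits in `Λ_{M+2}` iff the centre lies in `Λ_M`. [folklore] -/
theorem starBall2_subset_box_iff {M : ℕ} {i : Site d} : starBall2 i ⊆ box d (M + 2) ↔ i ∈ box d M := by
  constructor
  · intro h
    rw [mem_box]
    intro j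
    have h1 := mem_box.1 (h (mem_starBall2.2 (show supDist i (i + Pi.single j 2) ≤ 2 by
      rw [supDist_le_iff]; intro k; by_cases hk : k = j <;> simp [hk]))) j
    have h2 := mem_box.1 (h (mem_starBall2.2 (show supDist i (i - Pi.single j 2) ≤ 2 by
      rw [supDist_le_iff]; intro k; by_cases hk : k = j <;> simp [hk]))) j
    simp only [Pi.add_apply, Pi.sub_apply, Pi.single_eq_same] at h1 h2
    push_cast at h1 h2 ⊢
    constructor <;> omega
  · intro hi y hy
    have hi' := mem_box.1 hi
    have hy' := supDist_le_iff.1 (mem_starBall2.1 hy)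
    rw [mem_box]
    intro j
    have := hi' j; have := hy' j
    push_cast at *
    constructor <;> omega

/-- The core of `Λ_{M+2}` is `Λ_M`. [cite: FriedliVelenik2017, §7.3, Lemma 7.20] -/
theorem core_box (M : ℕ) : core (box d (M + 2)) = box d M := by
  ext i; rw [mem_core, starBall2_subset_box_iff]

/-- The `★`-ball fits in `Λ_{N+1}` iff the centre lies in `Λ_N`. [folklore] -/
theorem starBall_subset_box_iff {N : ℕ} {i : Site d} : starBall i ⊆ box d (N + 1) ↔ i ∈ box d N := by
  constructor
  · intro h
    rw [mem_box]
    intro j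
    have h1 := mem_box.1 (h (mem_starBall.2 (show supDist i (i + Pi.single j 1) ≤ 1 by
      rw [supDist_le_iff]; intro k; by_cases hk : k = j <;> simp [hk]))) j
    have h2 := mem_box.1 (h (mem_starBall.2 (show supDist i (i - Pi.single j 1) ≤ 1 by
      rw [supDist_le_iff]; intro k; by_cases hk : k = j <;> simp [hk]))) j
    simp only [Pi.add_apply, Pi.sub_apply, Pi.single_eq_same] at h1 h2
    push_cast at h1 h2 ⊢
    constructor <;> omega
  · intro hi y hy
    have hi' := mem_box.1 hi
    have hy' := supDist_le_iff.1 (mem_starBall.1 hy)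
    rw [mem_box]
    intro j
    have := hi' j; have := hy' j
    push_cast at *
    constructor <;> omega

/-- The inner volume of `Λ_{N+1}` is `Λ_N`. [folklore] -/
theorem inner1_box (N : ℕ) : inner1 (box d (N + 1)) = box d N := by
  ext i; rw [mem_inner1, starBall_subset_box_iff]

/-- A point of `Λ_M` off `Λ_{M-1}` has a coordinate `± M` (`M ≥ 1`). [folklore] -/
theorem exists_apply_eq_of_not_mem_box {M : ℕ} (hM : 1 ≤ M) {a : Site d} (ha : a ∈ box d M) (ha' : a ∉ box d (M - 1)) :
    ∃ k, a k = M ∨ a k = -(M : ℤ) := by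
  rw [mem_box] at ha ha'
  push Not at ha'
  obtain ⟨k, hk⟩ := ha'
  refine ⟨k, ?_⟩
  have := ha k
  have hM' : ((M - 1 : ℕ) : ℤ) = M - 1 := by push_cast [Nat.cast_sub hM]; ring
  rw [hM'] at hk
  omega

/-- **The free edges of the box `Λ_{M+2}`** (`M ≥ 1`): the lattice edges with both endpoints in `Λ_M` and an
endpoint in `Λ_{M-1}` — all edges of `Λ_M` except those inside the boundary layer `∂Λ_M`.
[cite: FriedliVelenik2017, §7.3, Lemma 7.20] -/
theorem mk_mem_freeEdges_box {M : ℕ} (hM : 1 ≤ M) {a b : Site d} (hab : (zdGraph d).Adj a b) :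
    s(a, b) ∈ freeEdges (box d (M + 2)) ↔ (a ∈ box d M ∧ b ∈ box d M) ∧ (a ∈ box d (M - 1) ∨ b ∈ box d (M - 1)) := by
  have heE : s(a, b) ∈ (zdGraph d).edgeSet := (SimpleGraph.mem_edgeSet _).2 hab
  rw [mem_freeEdges, core_box, coBall_mk]
  simp only [heE, true_and]
  have hM' : ((M - 1 : ℕ) : ℤ) = M - 1 := by push_cast [Nat.cast_sub hM]; ring
  constructor
  · intro h
    have ha : a ∈ box d M := h (mem_inter.2 ⟨mem_starBall_self a, mem_starBall_comm.1 (adj_iff_mem_starBall.1 (zdGraph_le_zdStar hab)).1⟩)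
    have hb : b ∈ box d M := h (mem_inter.2 ⟨(adj_iff_mem_starBall.1 (zdGraph_le_zdStar hab)).1, mem_starBall_self b⟩)
    refine ⟨⟨ha, hb⟩, ?_⟩
    by_contra hnot
    push Not at hnot
    obtain ⟨ha', hb'⟩ := hnot
    -- a far coordinate `k` transverse to the direction `i` of the edge
    have key : ∀ {x y : Site d} (i : Fin d), y = x + Pi.single i 1 → x ∈ box d M → y ∈ box d M → x ∉ box d (M - 1) → y ∉ box d (M - 1) →
        starBall x ∩ starBall y ⊆ box d M → False := by
      intro x y i hy hx hyM hx' hy' hsub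
      -- a coordinate `k ≠ i` with `x k = ± M`
      obtain ⟨k, hki, hk⟩ : ∃ k, k ≠ i ∧ (x k = M ∨ x k = -(M : ℤ)) := by
        obtain ⟨k, hk⟩ := exists_apply_eq_of_not_mem_box hM hx hx'
        by_cases hki : k = i
        · subst hki
          have hyk := (mem_box.1 hyM) k
          rw [hy] at hyk; simp only [Pi.add_apply, Pi.single_eq_same] at hyk
          have hxk : x k = -(M : ℤ) := by omega
          -- then `y k = -M + 1` and `y` is far in another coordinate
          obtain ⟨j, hj⟩ := exists_apply_eq_of_not_mem_box hM hyM hy'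
          have hji : j ≠ k := by
            rintro rfl; rw [hy] at hj; simp only [Pi.add_apply, Pi.single_eq_same] at hj; omega
          refine ⟨j, hji, ?_⟩
          rw [hy] at hj; simp only [Pi.add_apply, Pi.single_eq_of_ne hji, add_zero] at hj
          exact hj
        · exact ⟨k, hki, hk⟩
      -- the point one step further out in direction `k`
      set s : ℤ := if x k = M then 1 else -1 with hs
      set z : Site d := x + Pi.single k s with hz
      have hzx : z ∈ starBall x := by
        rw [mem_starBall, supDist_le_iff]; intro j
        by_cases hj : j = k
        · subst hj; simp only [hz, Pi.add_apply, Pi.single_eq_same, hs]; split_ifs <;> simp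
        · simp [hz, Pi.single_eq_of_ne hj]
      have hzy : z ∈ starBall y := by
        rw [mem_starBall, supDist_le_iff]; intro j
        rw [hy]
        by_cases hj : j = k
        · subst hj; simp only [hz, Pi.add_apply, Pi.single_eq_same, Pi.single_eq_of_ne hki, hs]; split_ifs <;> simp
        · by_cases hj' : j = i
          · subst hj'; simp [hz, Pi.single_eq_of_ne hj, Pi.single_eq_same]
          · simp [hz, Pi.single_eq_of_ne hj, Pi.single_eq_of_ne hj']
      have hzM := (mem_box.1 (hsub (mem_inter.2 ⟨hzx, hzy⟩))) k
      simp only [hz, Pi.add_apply, Pi.single_eq_same, hs] at hzM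
      split_ifs at hzM with hxk <;> omega
    obtain ⟨i, hi | hi⟩ := (zdGraph_adj_iff a b).1 hab
    · exact key i hi ha hb ha' hb' h
    · rw [inter_comm] at h; exact key i hi hb ha hb' ha' h
  · rintro ⟨-, h⟩ z hz
    obtain ⟨hza, hzb⟩ := mem_inter.1 hz
    rw [mem_box]; intro j
    rcases h with h | h
    · have h1 := (mem_box.1 h) j; have h2 := supDist_le_iff.1 (mem_starBall.1 hza) j
      rw [hM'] at h1; omega
    · have h1 := (mem_box.1 h) j; have h2 := supDist_le_iff.1 (mem_starBall.1 hzb) j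
      rw [hM'] at h1; omega

/-! ### 2. The box graphs -/

/-- **The ambient graph of the free edges of `Λ_{M+2}`**: lattice edges with an endpoint in `Λ_{M-1}`.
[cite: FriedliVelenik2017, §7.3, Lemma 7.20] -/
def ambM (d M : ℕ) : SimpleGraph (Site d) where
  Adj a b := (zdGraph d).Adj a b ∧ (a ∈ box d (M - 1) ∨ b ∈ box d (M - 1))
  symm := ⟨fun _ _ h => ⟨h.1.symm, h.2.symm⟩⟩
  loopless := ⟨fun _ h => h.1.ne rfl⟩

/-- Adjacency in `ambM` is decidable. [folklore] -/
instance (d M : ℕ) : DecidableRel (ambM d M).Adj := fun _ _ => inferInstanceAs (Decidable (_ ∧ _))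

/-- Adjacency in the ambient graph. [folklore] -/
theorem ambM_adj {M : ℕ} {a b : Site d} : (ambM d M).Adj a b ↔ (zdGraph d).Adj a b ∧ (a ∈ box d (M - 1) ∨ b ∈ box d (M - 1)) := Iff.rfl

/-- **The box graph of the free edges** ("spine graph"): the restriction of `ambM` to `Λ_M`, i.e. the graph
`E_{Λ_M}` of Grimmett with the edges inside `∂Λ_M` deleted. [cite: Grimmett2006, §4.2 (E_Λ)] -/
abbrev spineGraph (d M : ℕ) : SimpleGraph (↥(box d M)) := finsetGraph (ambM d M) (box d M)

/-- On `Λ_{M-1}` the ambient graph is the full lattice. [folklore] -/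
theorem finsetGraph_ambM_pred (M : ℕ) : finsetGraph (ambM d M) (box d (M - 1)) = finsetGraph (zdGraph d) (box d (M - 1)) := by
  ext x y
  rw [finsetGraph_adj_iff, finsetGraph_adj_iff, ambM_adj]
  exact ⟨fun h => h.1, fun h => ⟨h, Or.inl x.2⟩⟩

/-- Lifting an edge of the box to the lattice. [folklore] -/
def liftE {M : ℕ} : Sym2 (↥(box d M)) → Sym2 (Site d) := Sym2.map Subtype.val

/-- `liftE` on a pair. [folklore] -/
@[simp] theorem liftE_mk {M : ℕ} (x y : ↥(box d M)) : liftE s(x, y) = s(x.1, y.1) := rfl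

/-- `liftE` is injective. [folklore] -/
theorem liftE_injective {M : ℕ} : Function.Injective (liftE (d := d) (M := M)) := Sym2.map.injective Subtype.val_injective

/-- Membership of an edge in the edge set of the spine graph. [folklore] -/
theorem mk_mem_edgeFinset_spineGraph {M : ℕ} {x y : ↥(box d M)} :
    s(x, y) ∈ (spineGraph d M).edgeFinset ↔ (zdGraph d).Adj x.1 y.1 ∧ (x.1 ∈ box d (M - 1) ∨ y.1 ∈ box d (M - 1)) := by
  rw [SimpleGraph.mem_edgeFinset, SimpleGraph.mem_edgeSet]; exact Iff.rfl

/-- **The edges of the spine graph are the free edges of `Λ_{M+2}`.** [cite: FriedliVelenik2017, §7.3, Lemma 7.20] -/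
theorem image_liftE_edgeFinset {M : ℕ} (hM : 1 ≤ M) : (spineGraph d M).edgeFinset.image liftE = freeEdges (box d (M + 2)) := by
  ext e
  rw [mem_image]
  constructor
  · rintro ⟨e', he', rfl⟩
    induction e' using Sym2.ind with
    | h x y =>
      obtain ⟨hxy, hor⟩ := mk_mem_edgeFinset_spineGraph.1 he'
      exact (mk_mem_freeEdges_box hM hxy).2 ⟨⟨x.2, y.2⟩, hor⟩
  · intro he
    have heE := (mem_freeEdges.1 he).1
    induction e using Sym2.ind with
    | h a b =>
      have hab := (SimpleGraph.mem_edgeSet _).1 heE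
      obtain ⟨⟨ha, hb⟩, hor⟩ := (mk_mem_freeEdges_box hM hab).1 he
      exact ⟨s(⟨a, ha⟩, ⟨b, hb⟩), mk_mem_edgeFinset_spineGraph.2 ⟨hab, hor⟩, rfl⟩

/-- Lifted configurations of the box are configurations of the free edges. [folklore] -/
theorem image_liftE_subset {M : ℕ} (hM : 1 ≤ M) {ω' : Finset (Sym2 (↥(box d M)))} (hω' : ω' ⊆ (spineGraph d M).edgeFinset) :
    ω'.image liftE ⊆ freeEdges (box d (M + 2)) := by
  rw [← image_liftE_edgeFinset hM]; exact image_subset_image hω'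

/-- **The configurations of the free edges of `Λ_{M+2}` are the lifts of the configurations of the spine graph.**
[folklore] -/
theorem powerset_freeEdges_eq_image {M : ℕ} (hM : 1 ≤ M) :
    (freeEdges (box d (M + 2))).powerset = (spineGraph d M).edgeFinset.powerset.image (Finset.image liftE) := by
  ext ω
  rw [mem_powerset, mem_image]
  constructor
  · intro h
    refine ⟨(spineGraph d M).edgeFinset.filter fun e' => liftE e' ∈ ω, mem_powerset.2 (filter_subset _ _), ?_⟩
    ext e
    rw [mem_image]
    constructor
    · rintro ⟨e', he', rfl⟩; exact (mem_filter.1 he').2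
    · intro he
      obtain ⟨e', he', rfl⟩ := mem_image.1 (by rw [image_liftE_edgeFinset hM]; exact h he)
      exact ⟨e', mem_filter.2 ⟨he', he⟩, rfl⟩
  · rintro ⟨ω', hω', rfl⟩; exact image_liftE_subset hM (mem_powerset.1 hω')

/-! ### 3. The energy of a lifted configuration -/

/-- **Double counting**: for an edge set inside `U`, `Σ_{x ∈ U} #{y ~ x : xy ∈ ωt} = 2 |ωt|`. [folklore] -/
theorem sum_card_filter_mem_eq_two_mul (U : Finset (Site d)) {ωt : Finset (Sym2 (Site d))} (h : ωt ⊆ nnEdges U) :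
    ∑ x ∈ U, #((nbrs x).filter fun y => s(x, y) ∈ ωt) = 2 * #ωt := by
  have hmaps : Set.MapsTo (fun p : (Σ _ : Site d, Site d) => s(p.1, p.2))
      ↑(U.sigma fun x => (nbrs x).filter fun y => s(x, y) ∈ ωt) ↑ωt := fun p hp =>
    mem_coe.2 (mem_filter.1 (mem_sigma.1 (mem_coe.1 hp)).2).2
  rw [← card_sigma, card_eq_sum_card_fiberwise hmaps, mul_comm, ← smul_eq_mul, ← sum_const]
  refine sum_congr rfl fun e he => ?_
  induction e using Sym2.ind with
  | h a b =>
    obtain ⟨hab, ha, hb⟩ := mk_mem_nnEdges.1 (h he)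
    have hne : a ≠ b := hab.ne
    have hfib : ((U.sigma fun x => (nbrs x).filter fun y => s(x, y) ∈ ωt).filter fun p => s(p.1, p.2) = s(a, b)) =
        {(⟨a, b⟩ : Σ _ : Site d, Site d), ⟨b, a⟩} := by
      ext ⟨x, y⟩
      simp only [mem_filter, mem_sigma, mem_insert, mem_singleton, Sym2.eq_iff, mem_nbrs]
      constructor
      · rintro ⟨-, ⟨rfl, rfl⟩ | ⟨rfl, rfl⟩⟩
        · exact Or.inl rfl
        · exact Or.inr rfl
      · rintro (h' | h')
        · cases h'; exact ⟨⟨ha, hab, he⟩, Or.inl ⟨rfl, rfl⟩⟩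
        · cases h'; exact ⟨⟨hb, hab.symm, by rw [Sym2.eq_swap]; exact he⟩, Or.inr ⟨rfl, rfl⟩⟩
    rw [hfib, card_insert_of_notMem, card_singleton]
    rw [mem_singleton]
    intro h'
    exact hne (congrArg Sigma.fst h')

/-- The free edges have their endpoints in the volume. [folklore] -/
theorem freeEdges_subset_nnEdges (V : Finset (Site d)) : freeEdges V ⊆ nnEdges V := by
  intro e he
  obtain ⟨heE, hc⟩ := mem_freeEdges.1 he
  exact mem_nnEdges.2 ⟨heE, fun z hz => inner1_subset V (core_subset_inner1 V (hc (mem_coBall_of_mem heE hz)))⟩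

/-- **The energy of a `dis` configuration is twice its number of edges.** [cite: Grimmett2006, §7.5, eq. (7.63)] -/
theorem energy_dis_eq {V : Finset (Site d)} {ωt : Finset (Sym2 (Site d))} (hω : ωt ⊆ freeEdges V) :
    energy Phase.dis (freeEdges V) ωt V = 2 * #ωt := by
  rw [energy, ← sum_card_filter_mem_eq_two_mul V (hω.trans (freeEdges_subset_nnEdges V))]
  refine sum_congr rfl fun x _ => ?_
  rw [oDeg]
  exact congrArg _ (filter_congr fun y _ => by simp [EOpen])

/-- The number of pinned (non-free) half-edges of a volume: a constant of the volume. [folklore] -/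
def pinned (V : Finset (Site d)) : ℕ := ∑ x ∈ V, #((nbrs x).filter fun y => s(x, y) ∉ freeEdges V)

/-- **The energy of an `ord` configuration**: twice its number of edges plus the pinned half-edges.
[cite: Grimmett2006, §7.5, eq. (7.63)] -/
theorem energy_ord_eq {V : Finset (Site d)} {ωt : Finset (Sym2 (Site d))} (hω : ωt ⊆ freeEdges V) :
    energy Phase.ord (freeEdges V) ωt V = 2 * #ωt + pinned V := by
  rw [energy, pinned, ← sum_card_filter_mem_eq_two_mul V (hω.trans (freeEdges_subset_nnEdges V)), ← sum_add_distrib]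
  refine sum_congr rfl fun x _ => ?_
  have hdisj : Disjoint ((nbrs x).filter fun y => s(x, y) ∈ ωt) ((nbrs x).filter fun y => s(x, y) ∉ freeEdges V) :=
    Finset.disjoint_left.2 fun y hy hy' => (mem_filter.1 hy').2 (hω (mem_filter.1 hy).2)
  rw [oDeg, ← card_union_of_disjoint hdisj, ← filter_or]
  exact congrArg _ (filter_congr fun y _ => by simp [EOpen])

/-- The number of edges of a lifted configuration. [folklore] -/
theorem card_image_liftE {M : ℕ} (ω' : Finset (Sym2 (↥(box d M)))) : #(ω'.image liftE) = #ω' :=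
  card_image_of_injective _ liftE_injective

/-! ### 4. Class counts as connected components; the cluster functional of a lifted configuration -/

section ClassGraph

variable {α : Type*} [DecidableEq α] {U : Finset α} {R : α → α → Prop}

/-- Reachability in a graph on `↥U` matching `R` off the diagonal is the chain relation of `R` inside `U`.
[folklore] -/
theorem reachable_iff_reflTransGen (H : SimpleGraph U) (hH : ∀ x y : U, x ≠ y → (H.Adj x y ↔ R x.1 y.1)) (x y : U) :
    H.Reachable x y ↔ ReflTransGen (relIn R U) x.1 y.1 := by
  constructor
  · rintro ⟨p⟩
    induction p with
    | nil => exact ReflTransGen.refl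
    | cons hadj _ ih => exact ReflTransGen.head ⟨(hH _ _ hadj.ne).1 hadj, Subtype.coe_prop _, Subtype.coe_prop _⟩ ih
  · suffices key : ∀ (a c : α), ReflTransGen (relIn R U) a c → ∀ (ha : a ∈ U) (hc : c ∈ U), H.Reachable ⟨a, ha⟩ ⟨c, hc⟩ from
      fun h => key _ _ h x.2 y.2
    intro a c h
    induction h with
    | refl => intro ha hc; exact SimpleGraph.Reachable.refl _
    | tail _ hbc ih =>
      intro ha hc
      by_cases hbc' : (⟨_, hbc.2.1⟩ : U) = ⟨_, hc⟩
      · rw [← hbc']; exact ih ha hbc.2.1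
      · exact (ih ha hbc.2.1).trans (SimpleGraph.Adj.reachable ((hH _ _ hbc').2 hbc.1))

/-- **The number of classes of `R` inside `U` is the number of connected components** of any graph on `↥U`
whose adjacency off the diagonal is `R` (symmetric `R`). [folklore] -/
theorem ccount_eq_natCard_connectedComponent (hR : ∀ a b, R a b → R b a) (H : SimpleGraph U)
    (hH : ∀ x y : U, x ≠ y → (H.Adj x y ↔ R x.1 y.1)) : ccount R U = Nat.card H.ConnectedComponent := by
  classical
  have hreach := reachable_iff_reflTransGen H hH
  -- the class of a component
  set F : H.ConnectedComponent → Finset α :=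
    SimpleGraph.ConnectedComponent.lift (fun x => cls R U x.1) (fun x y p _ =>
      (cls_eq_of_mem hR (mem_cls.2 ⟨y.2, (hreach x y).1 p.reachable⟩)).symm) with hF
  have hFmk : ∀ x, F (H.connectedComponentMk x) = cls R U x.1 := fun x => SimpleGraph.ConnectedComponent.lift_mk
  have hmem : ∀ c, F c ∈ U.image (cls R U) := fun c => by
    induction c using SimpleGraph.ConnectedComponent.ind with
    | h x => rw [hFmk]; exact mem_image_of_mem _ x.2
  set F' : H.ConnectedComponent → ↥(U.image (cls R U)) := fun c => ⟨F c, hmem c⟩ with hF'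
  have hbij : Function.Bijective F' := by
    constructor
    · intro c c' h
      have h' : F c = F c' := congrArg Subtype.val h
      induction c using SimpleGraph.ConnectedComponent.ind with
      | h x =>
        induction c' using SimpleGraph.ConnectedComponent.ind with
        | h y =>
          rw [hFmk, hFmk] at h'
          have hy : y.1 ∈ cls R U x.1 := h' ▸ mem_cls_self y.2
          exact SimpleGraph.ConnectedComponent.sound ((hreach x y).2 (mem_cls.1 hy).2)
    · rintro ⟨C, hC⟩
      obtain ⟨x, hx, rfl⟩ := mem_image.1 hC
      exact ⟨H.connectedComponentMk ⟨x, hx⟩, Subtype.ext (hFmk _)⟩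
  rw [ccount, Nat.card_eq_of_bijective F' hbij, Nat.card_eq_fintype_card, Fintype.card_coe]

end ClassGraph

section Kappa

variable {M : ℕ}

/-- The origin lies in every box. [folklore] -/
theorem zero_mem_box (n : ℕ) : (0 : Site d) ∈ box d n := by
  rw [mem_box]; intro i; simp only [Pi.zero_apply]; constructor <;> omega

/-- The endpoints of a lifted edge lie in the box. [folklore] -/
theorem mem_box_of_mk_mem_image_liftE {ω' : Finset (Sym2 (↥(box d M)))} {a b : Site d} (h : s(a, b) ∈ ω'.image liftE) :
    a ∈ box d M ∧ b ∈ box d M := by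
  obtain ⟨e', -, he'⟩ := mem_image.1 h
  induction e' using Sym2.ind with
  | h x y =>
    rw [liftE_mk, Sym2.eq_iff] at he'
    rcases he' with ⟨rfl, rfl⟩ | ⟨rfl, rfl⟩
    · exact ⟨x.2, y.2⟩
    · exact ⟨y.2, x.2⟩

/-- Membership of a lifted pair. [folklore] -/
theorem mk_mem_image_liftE_iff {ω' : Finset (Sym2 (↥(box d M)))} (x y : ↥(box d M)) : s(x.1, y.1) ∈ ω'.image liftE ↔ s(x, y) ∈ ω' := by
  rw [← liftE_mk, mem_image]
  constructor
  · rintro ⟨e', he', h⟩; rwa [← liftE_injective h]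
  · intro h; exact ⟨_, h, rfl⟩

/-- Open adjacency for `dis` boundary condition. [folklore] -/
theorem rOpen_dis_iff {F ω : Finset (Sym2 (Site d))} {a b : Site d} : ROpen Phase.dis F ω a b ↔ (zdGraph d).Adj a b ∧ s(a, b) ∈ ω := by
  simp [ROpen, EOpen]

/-- Open adjacency for `ord` boundary condition. [folklore] -/
theorem rOpen_ord_iff {F ω : Finset (Sym2 (Site d))} {a b : Site d} :
    ROpen Phase.ord F ω a b ↔ (zdGraph d).Adj a b ∧ (s(a, b) ∈ ω ∨ s(a, b) ∉ F) := by
  simp [ROpen, EOpen]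

/-- **The `dis` cluster functional of a lifted configuration**: the free clusters of the spine graph plus the
sites of `Λ_{M+2} ∖ Λ_M`, which are isolated. [cite: Grimmett2006, §4.2 and §7.5, eq. (7.66)] -/
theorem kappa_dis_box {ω' : Finset (Sym2 (↥(box d M)))} (hω' : ω' ⊆ (spineGraph d M).edgeFinset) :
    kappa Phase.dis (box d (M + 2)) (freeEdges (box d (M + 2))) (ω'.image liftE) =
      clusterCount (↑ω' : Percolation.BondConfig (↥(box d M))) ∅ + #(box d (M + 2) \ box d M) := by
  set ωt := ω'.image liftE with hωt
  set R := ROpen Phase.dis (freeEdges (box d (M + 2))) ωt with hR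
  have hRsymm : ∀ a b, R a b → R b a := rOpen_symm _ _ _
  change ccount R (box d (M + 2)) = _
  have hsub : box d M ⊆ box d (M + 2) := box_mono d (by omega)
  have hV : box d (M + 2) = box d M ∪ (box d (M + 2) \ box d M) := (union_sdiff_of_subset hsub).symm
  have hsep : ∀ a ∈ box d M, ∀ b ∈ box d (M + 2) \ box d M, ¬ R a b ∧ ¬ R b a := by
    intro a _ b hb
    have hb' : b ∉ box d M := (mem_sdiff.1 hb).2
    exact ⟨fun h => hb' (mem_box_of_mk_mem_image_liftE (rOpen_dis_iff.1 h).2).2,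
      fun h => hb' (mem_box_of_mk_mem_image_liftE (rOpen_dis_iff.1 h).2).1⟩
  rw [hV, ccount_union_of_separated hsep disjoint_sdiff, ← hV,
    ccount_eq_card_of_forall_not fun a ha b _ h => (mem_sdiff.1 ha).2 (mem_box_of_mk_mem_image_liftE (rOpen_dis_iff.1 h).2).1]
  congr 1
  rw [clusterCount, wired_empty, sup_bot_eq]
  refine ccount_eq_natCard_connectedComponent hRsymm _ fun x y hxy => ?_
  rw [Percolation.openGraph_adj, mem_coe, hR, rOpen_dis_iff, mk_mem_image_liftE_iff]
  exact ⟨fun h => ⟨(mk_mem_edgeFinset_spineGraph.1 (hω' h.1)).1, h.1⟩, fun h => ⟨h.2, hxy⟩⟩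

/-- The inner vertex boundary of a box (`M ≥ 1`). [cite: Grimmett2006, §4.2 (∂Λ)] -/
theorem mem_innerBoundary_box_iff (hM : 1 ≤ M) {a : Site d} :
    a ∈ innerBoundary (zdGraph d) (box d M) ↔ a ∈ box d M ∧ a ∉ box d (M - 1) := by
  have hM' : ((M - 1 : ℕ) : ℤ) = M - 1 := by push_cast [Nat.cast_sub hM]; ring
  constructor
  · intro h
    obtain ⟨ha, y, hy, hay⟩ := mem_innerBoundary_iff.1 h
    refine ⟨ha, fun ha' => hy ?_⟩
    rw [mem_box] at ha' ⊢
    intro j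
    obtain ⟨i, hi | hi⟩ := (zdGraph_adj_iff a y).1 hay
    · have := ha' j; rw [hi, hM'] at *; by_cases hj : j = i
      · subst hj; simp only [Pi.add_apply, Pi.single_eq_same]; omega
      · simp only [Pi.add_apply, Pi.single_eq_of_ne hj, add_zero]; omega
    · have h1 := ha' j; rw [hM'] at h1
      have h2 : y j = a j - (Pi.single i (1 : ℤ) : Site d) j := by rw [hi]; simp
      rw [h2]; by_cases hj : j = i
      · subst hj; simp only [Pi.single_eq_same]; omega
      · simp only [Pi.single_eq_of_ne hj, sub_zero]; omega
  · rintro ⟨ha, ha'⟩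
    obtain ⟨k, hk | hk⟩ := exists_apply_eq_of_not_mem_box hM ha ha'
    · exact mem_innerBoundary_box_of_apply_eq ha k hk
    · exact mem_innerBoundary_box_of_apply_eq_neg ha k hk

/-- **From a site off `Λ_{M-1}` outwards to the boundary layer of `Λ_{M+2}` through pinned open edges** (`ord`).
[cite: Grimmett2006, §7.5 (the exterior wired cluster)] -/
theorem exists_chain_to_layer (hM : 1 ≤ M) {ωt : Finset (Sym2 (Site d))} {a : Site d} (ha : a ∈ box d (M + 2)) (ha' : a ∉ box d (M - 1)) :
    ∃ ℓ ∈ box d (M + 2) \ box d (M + 1),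
      ReflTransGen (relIn (ROpen Phase.ord (freeEdges (box d (M + 2))) ωt) (box d (M + 2))) a ℓ := by
  have hM' : ((M - 1 : ℕ) : ℤ) = M - 1 := by push_cast [Nat.cast_sub hM]; ring
  -- a coordinate `k` with `|a k| ≥ M` and the outward sign `sg`
  obtain ⟨k, hk⟩ : ∃ k, ¬ (-((M - 1 : ℕ) : ℤ) ≤ a k ∧ a k ≤ ((M - 1 : ℕ) : ℤ)) := by
    rw [mem_box] at ha'; push Not at ha'
    obtain ⟨k, hk⟩ := ha'
    exact ⟨k, fun h => (hk h.1).not_ge h.2⟩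
  rw [hM'] at hk
  obtain ⟨sg, hsg, hak⟩ : ∃ sg : ℤ, (sg = 1 ∨ sg = -1) ∧ (M : ℤ) ≤ sg * a k := by
    by_cases h0 : 0 ≤ a k
    · exact ⟨1, Or.inl rfl, by omega⟩
    · exact ⟨-1, Or.inr rfl, by omega⟩
  -- one outward step from a site `z` with `M ≤ sg * z k < M + 2`
  have step : ∀ z : Site d, z ∈ box d (M + 2) → (M : ℤ) ≤ sg * z k → sg * z k < M + 2 →
      z + Pi.single k sg ∈ box d (M + 2) ∧
        relIn (ROpen Phase.ord (freeEdges (box d (M + 2))) ωt) (box d (M + 2)) z (z + Pi.single k sg) := by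
    intro z hz hlo hhi
    have hzV := mem_box.1 hz
    have hz' : z + Pi.single k sg ∈ box d (M + 2) := by
      rw [mem_box]; intro j
      by_cases hj : j = k
      · subst hj; simp only [Pi.add_apply, Pi.single_eq_same]; have := hzV j; push_cast at *; rcases hsg with rfl | rfl <;> omega
      · simp only [Pi.add_apply, Pi.single_eq_of_ne hj, add_zero]; exact hzV j
    have hadj : (zdGraph d).Adj z (z + Pi.single k sg) := by
      rw [zdGraph_adj_iff]; refine ⟨k, ?_⟩
      rcases hsg with rfl | rfl
      · exact Or.inl rfl
      · right; rw [add_assoc, ← Pi.single_add]; simp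
    have hnf : s(z, z + Pi.single k sg) ∉ freeEdges (box d (M + 2)) := by
      rw [mk_mem_freeEdges_box hM hadj]
      rintro ⟨-, h | h⟩
      · have := (mem_box.1 h) k; rw [hM'] at this; rcases hsg with rfl | rfl <;> omega
      · have := (mem_box.1 h) k; rw [hM'] at this; simp only [Pi.add_apply, Pi.single_eq_same] at this
        rcases hsg with rfl | rfl <;> omega
    exact ⟨hz', rOpen_ord_iff.2 ⟨hadj, Or.inr hnf⟩, hz, hz'⟩
  have hakhi : sg * a k ≤ M + 2 := by have := (mem_box.1 ha) k; push_cast at *; rcases hsg with rfl | rfl <;> omega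
  have finish : ∀ z : Site d, z ∈ box d (M + 2) → sg * z k = M + 2 → z ∈ box d (M + 2) \ box d (M + 1) := by
    intro z hz hzk
    refine mem_sdiff.2 ⟨hz, fun h => ?_⟩
    have := (mem_box.1 h) k; push_cast at *; rcases hsg with rfl | rfl <;> omega
  have hk1 : sg * (a + Pi.single k sg : Site d) k = sg * a k + 1 := by
    simp only [Pi.add_apply, Pi.single_eq_same]; rcases hsg with rfl | rfl <;> ring
  have hk2 : sg * (a + Pi.single k sg + Pi.single k sg : Site d) k = sg * a k + 2 := by
    simp only [Pi.add_apply, Pi.single_eq_same]; rcases hsg with rfl | rfl <;> ring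
  by_cases h2 : sg * a k = M + 2
  · exact ⟨a, finish a ha h2, ReflTransGen.refl⟩
  obtain ⟨ha1, hst1⟩ := step a ha hak (by omega)
  by_cases h1 : sg * a k = M + 1
  · exact ⟨_, finish _ ha1 (by rw [hk1, h1]; ring), ReflTransGen.single hst1⟩
  obtain ⟨ha2, hst2⟩ := step _ ha1 (by rw [hk1]; omega) (by rw [hk1]; omega)
  exact ⟨_, finish _ ha2 (by rw [hk2]; omega), (ReflTransGen.single hst1).tail hst2⟩

/-- **The `ord` cluster functional of a lifted configuration**: the wired clusters of the spine graph (boundary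
`∂Λ_M` wired), minus one. [cite: Grimmett2006, §4.2 (4.12) and §7.5, eq. (7.66)] -/
theorem kappa_ord_box (hd : 1 ≤ d) (hM : 1 ≤ M) {ω' : Finset (Sym2 (↥(box d M)))} (hω' : ω' ⊆ (spineGraph d M).edgeFinset) :
    kappa Phase.ord (box d (M + 2)) (freeEdges (box d (M + 2))) (ω'.image liftE) + 1 =
      clusterCount (↑ω' : Percolation.BondConfig (↥(box d M))) (wiredBoundary (zdGraph d) (box d M)) := by
  set V := box d (M + 2) with hVdef
  set ωt := ω'.image liftE with hωt
  set R₀ := ROpen Phase.ord (freeEdges V) ωt with hR₀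
  set L := V \ inner1 V with hL
  set R := wire R₀ L with hR
  set Bk := V \ box d (M - 1) with hBk
  set D := box d M \ box d (M - 1) with hD
  have hR₀symm : ∀ a b, R₀ a b → R₀ b a := rOpen_symm _ _ _
  have hRsymm : ∀ a b, R a b → R b a := wire_symm hR₀symm L
  have hLbox : L = V \ box d (M + 1) := by rw [hL, hVdef, inner1_box]
  have hsubM : box d M ⊆ V := box_mono d (by omega)
  have hsubM1 : box d (M - 1) ⊆ box d M := box_mono d (Nat.sub_le M 1)
  -- `kappa + 1 = ccount R V`
  have hpos : 0 < ccount R V := ccount_pos ⟨0, by rw [hVdef]; exact zero_mem_box _⟩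
  have hk : kappa Phase.ord V (freeEdges V) ωt + 1 = ccount R V := by
    change ccount R V - 1 + 1 = ccount R V; omega
  rw [hk]
  -- (i) wiring the shell `Bk`, which lies in one class
  have hBkconn : ∀ a ∈ Bk, ∀ b ∈ Bk, ReflTransGen (relIn R V) a b := by
    have hchain : ∀ a ∈ Bk, ∃ ℓ ∈ L, ReflTransGen (relIn R V) a ℓ := by
      intro a ha
      obtain ⟨haV, ha'⟩ := mem_sdiff.1 ha
      rw [hVdef] at haV
      obtain ⟨ℓ, hℓ, hc⟩ := exists_chain_to_layer hM (ωt := ωt) haV ha'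
      refine ⟨ℓ, by rw [hLbox, hVdef]; exact hℓ, ?_⟩
      rw [hR, hR₀, hVdef]
      exact reflTransGen_mono (fun a _ b _ h => Or.inl h) hc
    intro a ha b hb
    obtain ⟨ℓ, hℓ, hac⟩ := hchain a ha
    obtain ⟨ℓ', hℓ', hbc⟩ := hchain b hb
    have hℓℓ' : ReflTransGen (relIn R V) ℓ ℓ' := ReflTransGen.single ⟨Or.inr ⟨hℓ, hℓ'⟩, (mem_sdiff.1 hℓ).1, (mem_sdiff.1 hℓ').1⟩
    exact (hac.trans hℓℓ').trans (reflTransGen_symm hRsymm hbc)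
  have hwire := ccount_wire_eq (R := R) (U := V) (L := Bk) hBkconn
  rw [← hwire]
  -- (ii) gluing `Λ_M` and the shell along `∂Λ_M`
  have hVU : V = box d M ∪ Bk := by
    ext x; rw [mem_union, hBk, mem_sdiff]
    constructor
    · intro hx; by_cases h : x ∈ box d (M - 1)
      · exact Or.inl (hsubM1 h)
      · exact Or.inr ⟨hx, h⟩
    · rintro (h | ⟨h, -⟩)
      · exact hsubM h
      · exact h
  have hInter : box d M ∩ Bk = D := by
    ext x; rw [mem_inter, hBk, hD, mem_sdiff, mem_sdiff]
    exact ⟨fun ⟨h1, _, h3⟩ => ⟨h1, h3⟩, fun ⟨h1, h3⟩ => ⟨h1, hsubM h1, h3⟩⟩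
  have hDne : D.Nonempty := by
    refine ⟨Pi.single ⟨0, hd⟩ (M : ℤ), mem_sdiff.2 ⟨?_, fun h => ?_⟩⟩
    · rw [mem_box]; intro j; rw [Pi.single_apply]; split_ifs <;> omega
    · have := (mem_box.1 h) ⟨0, hd⟩
      have hM' : ((M - 1 : ℕ) : ℤ) = M - 1 := by push_cast [Nat.cast_sub hM]; ring
      rw [hM', Pi.single_eq_same] at this; omega
  have hLdis : ∀ a ∈ box d M, a ∉ L := fun a ha haL => by
    rw [hLbox] at haL; exact (mem_sdiff.1 haL).2 (box_mono d (by omega) ha)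
  have hsep : ∀ a ∈ box d M, a ∉ D → ∀ b ∈ Bk, b ∉ D → ¬ wire R Bk a b ∧ ¬ wire R Bk b a := by
    intro a ha haD b hb hbD
    have haM1 : a ∈ box d (M - 1) := by by_contra h; exact haD (mem_sdiff.2 ⟨ha, h⟩)
    have hbM : b ∉ box d M := fun h => hbD (mem_sdiff.2 ⟨h, (mem_sdiff.1 hb).2⟩)
    have haBk : a ∉ Bk := fun h => (mem_sdiff.1 h).2 haM1
    have key : ∀ {x y}, (zdGraph d).Adj x y → x ∈ box d (M - 1) → y ∈ box d M := by
      intro x y hxy hx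
      have hM' : ((M - 1 : ℕ) : ℤ) = M - 1 := by push_cast [Nat.cast_sub hM]; ring
      rw [mem_box] at hx ⊢; intro j; have := hx j; rw [hM'] at this
      obtain ⟨i, hi | hi⟩ := (zdGraph_adj_iff x y).1 hxy
      · rw [hi]; by_cases hj : j = i
        · subst hj; simp only [Pi.add_apply, Pi.single_eq_same]; omega
        · simp only [Pi.add_apply, Pi.single_eq_of_ne hj, add_zero]; omega
      · have h2 : y j = x j - (Pi.single i (1 : ℤ) : Site d) j := by rw [hi]; simp
        rw [h2]; by_cases hj : j = i
        · subst hj; simp only [Pi.single_eq_same]; omega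
        · simp only [Pi.single_eq_of_ne hj, sub_zero]; omega
    refine ⟨?_, ?_⟩
    · rintro ((h | ⟨haL, -⟩) | ⟨h, -⟩)
      · exact hbM (key (rOpen_ord_iff.1 h).1 haM1)
      · exact hLdis a ha haL
      · exact haBk h
    · rintro ((h | ⟨-, haL⟩) | ⟨-, h⟩)
      · exact hbM (key (rOpen_ord_iff.1 h).1.symm haM1)
      · exact hLdis a ha haL
      · exact haBk h
  have hDBk : D ⊆ Bk := fun x hx => mem_sdiff.2 ⟨hsubM (mem_sdiff.1 hx).1, (mem_sdiff.1 hx).2⟩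
  have hL₁ : ∀ a ∈ D, ∀ b ∈ D, ReflTransGen (relIn (wire R Bk) (box d M)) a b := fun a ha b hb =>
    ReflTransGen.single ⟨Or.inr ⟨hDBk ha, hDBk hb⟩, (mem_sdiff.1 ha).1, (mem_sdiff.1 hb).1⟩
  have hL₂ : ∀ a ∈ D, ∀ b ∈ D, ReflTransGen (relIn (wire R Bk) Bk) a b := fun a ha b hb =>
    ReflTransGen.single ⟨Or.inr ⟨hDBk ha, hDBk hb⟩, hDBk ha, hDBk hb⟩
  have hglue := ccount_union_add_one (wire_symm hRsymm Bk) hInter hDne hsep hL₁ hL₂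
  have hone : ccount (wire R Bk) Bk = 1 :=
    ccount_eq_one (hDne.mono hDBk) fun a ha b hb => ReflTransGen.single ⟨Or.inr ⟨ha, hb⟩, ha, hb⟩
  rw [← hVU, hone] at hglue
  have hV' : ccount (wire R Bk) V = ccount (wire R Bk) (box d M) := by omega
  rw [hV']
  -- (iii) on `Λ_M` the relation is "open edge or both on `∂Λ_M`"
  set Rw := wire (fun a b => (zdGraph d).Adj a b ∧ s(a, b) ∈ ωt) D with hRwdef
  have hRw : ∀ a ∈ box d M, ∀ b ∈ box d M, (wire R Bk a b ↔ Rw a b) := by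
    intro a ha b hb
    have haBk : a ∈ Bk ↔ a ∈ D := ⟨fun h => mem_sdiff.2 ⟨ha, (mem_sdiff.1 h).2⟩, fun h => hDBk h⟩
    have hbBk : b ∈ Bk ↔ b ∈ D := ⟨fun h => mem_sdiff.2 ⟨hb, (mem_sdiff.1 h).2⟩, fun h => hDBk h⟩
    rw [hRwdef, wire, wire, haBk, hbBk, hR, wire, hR₀, rOpen_ord_iff]
    constructor
    · rintro ((⟨hab, hmem | hnf⟩ | ⟨haL, -⟩) | h)
      · exact Or.inl ⟨hab, hmem⟩
      · right
        rw [hVdef, mk_mem_freeEdges_box hM hab] at hnf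
        push Not at hnf
        obtain ⟨h1, h2⟩ := hnf ⟨ha, hb⟩
        exact ⟨mem_sdiff.2 ⟨ha, h1⟩, mem_sdiff.2 ⟨hb, h2⟩⟩
      · exact absurd haL (hLdis a ha)
      · exact Or.inr h
    · rintro (⟨hab, hmem⟩ | h)
      · exact Or.inl (Or.inl ⟨hab, Or.inl hmem⟩)
      · exact Or.inr h
  rw [ccount_congr hRw]
  -- (iv) the wired open graph of the spine box
  have hRwsymm : ∀ a b, Rw a b → Rw b a :=
    wire_symm (fun a b h => ⟨h.1.symm, by rw [Sym2.eq_swap]; exact h.2⟩) D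
  refine ccount_eq_natCard_connectedComponent hRwsymm _ fun x y hxy => ?_
  rw [SimpleGraph.sup_adj, Percolation.openGraph_adj, wired_adj, mem_wiredBoundary_iff, mem_wiredBoundary_iff,
    mem_innerBoundary_box_iff hM, mem_innerBoundary_box_iff hM, mem_coe, hRwdef, wire, mk_mem_image_liftE_iff]
  constructor
  · rintro (⟨h, -⟩ | ⟨-, ⟨-, hx⟩, ⟨-, hy⟩⟩)
    · exact Or.inl ⟨(mk_mem_edgeFinset_spineGraph.1 (hω' h)).1, h⟩
    · exact Or.inr ⟨mem_sdiff.2 ⟨x.2, hx⟩, mem_sdiff.2 ⟨y.2, hy⟩⟩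
  · rintro (⟨-, h⟩ | ⟨hx, hy⟩)
    · exact Or.inl ⟨h, hxy⟩
    · exact Or.inr ⟨hxy, ⟨x.2, (mem_sdiff.1 hx).2⟩, ⟨y.2, (mem_sdiff.1 hy).2⟩⟩

end Kappa

end RCC

end Literature.Probability.LatticeModels
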